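import Summits.QuantumFields.YangMills.Theorems.UV3PinnedStepOrganOfTopPartialIterates
import Summits.QuantumFields.YangMills.Theorems.BalabanUVNodesN08PartialIteratesNecessity
import HarnessLib

/-!
# R3 (cell `ym3-torus`, YM₃ on T³ — a ladder RUNG, NOT d = 4, NOT infinite volume, NOT a mass gap, NOT the Clay problem) —
# **THE TOP-LEVEL KINEMATIC ROW hTop FROM A WEAKLY-CLOSED FAMILY CAPPED AT THE TOP LEVEL ONLY** (the top-only reading of the N08 seat's v1 letter)

Width seat `ym-ust-19936-w3` g19 on crux `stmt-QuantumFields-19936` (`--supports`, helper; THEOREMS ONLY, 0 `def`, 0 `sorry`; bookkeeping, closes nothing).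
Companion of ✓`UV3PinnedStepOrganOfTopPartialIterates` (K-21-TOP), ✓`UnitScaleTiltHistoryTailOfPackageTopPartialIterates` (K-23-TOP: `HistoryTailL` ⟸ guarded socket ∧ π ∧ hMain ∧ hTop),
`ym3-torus-px8` g12's ✓`UV3StartClosedOfTopHaarPushforward` (hTop ⟹ the v3 per-start family, FLAT), `ym-ust-19936-w6` g7's ✓`UV3PinnedMassEnvelopeV3OfN08` and `dag-n08-d` g47's
✓`BalabanUVNodesN08KFoldTransportEnvelopeT3` (the N08 loop-part letters at `avT3 F K`).

THE POINT.  g47's v1 letter hN08 asks, at every run `K`, for a family `ν` of measures WEAKLY CLOSED under the pinned averaging — `(dU_k + ν_k)∘Ū_k⁻¹ ≤ dU_{k+1} + ν_{k+1}`,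
`k < K` — AND CAPPED AT EVERY LEVEL, `ν_k ≤ (e^{A₁} − 1)·dU_k` for all `k ≤ K`, with ONE `A₁`.  As for the all-levels (a)′∀ (LEAD ★w1 g11's 01:14Z flag; ★★OWNER WORD 68), the caps at
the intermediate levels `k < K` sit on lattices of `(2L^{m+K−k})³` sites and are the volume-extensive object; only the TOP cap is read.  THIS FILE records the top-only
reading in the kernel: weak closure at all levels (structural — e.g. N08 file 17's excess family `ν♯` is ALWAYS weakly closed) plus the ONE cap `ν_K ≤ C·dU_K` at the unit
torus already give every segment's push-forward bound `(dU_j)∘(Ū_{K−1}∘⋯∘Ū_j)⁻¹ ≤ (1 + C)·dU_K` (N08 file 30 §1 ✓`partialIterates_le_add_of_weakClosed` — closure only — read along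
`iterFrom` by ✓`partialIterates_eq_map_iterFrom`), i.e. hTop with `e^{c} = 1 + C`; so the N08 seat's v1 target may be lettered «weakly closed + top cap» and lands on the
v5-candidate row hTop by name (then on the crux by ✓K-23-TOP in v1, by `ym-ust-19936-w8` g11's v3 face in v3).

CONTENTS.
* §1 (generic `P`, `G`, any averaging family with `AvgAC`) ★★ `map_iterFrom_le_of_weakClosed_topCap` — closure for `k < Kt` + `ν_Kt ≤ C·dU_Kt` ⇒ `(dU_j)∘(iterFrom av j n)⁻¹ ≤ (1 + C)·dU_{j+n}`
  for `j + n = Kt`.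
* §2 (lane, per family) ★★ `topHaarPushforward_of_weakClosed_topCap_avT3 (hN08top : ∃ A ≥ 0, ∀ K, ∃ ν, ⟨closure under avT3 F K, k < K⟩ ∧ ν K ≤ ofReal (e^{A} − 1) • dU_K) : hTop F`;
  `weakClosed_topCap_of_weakClosed_avT3` (g47's all-levels letter ⇒ the top-only letter, trivially); ★ `topHaarPushforward_of_weakClosed_avT3` (hence g47's letter ⇒ hTop).

HONEST SCOPE.  [folklore] measure bookkeeping; hN08top ∕ hN08 ∕ hTop are DISPLAYED letters, NOT proved (OPEN for `blockAvg ℰp`: the N08 loop part); nothing of `stub_pinnedStep`,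
`stub_unitEnvelope`, `HistoryTailL` (19936), the rung `YM3TorusSU2`, d = 4, infinite volume, a mass gap or Clay is proved here.  YM₃ on T³ is rung R3 of the ladder, not the Clay problem.

References: T. Bałaban, Commun. Math. Phys. **102** (1985) 255–275 [Balaban1985UV3] ((2) p. 256, (5) p. 257, (41) p. 266); T. Bałaban, Commun. Math. Phys. **98** (1985) 17–51
[Balaban1985Averaging] ((10), (15) p. 19); T. Bałaban, Commun. Math. Phys. **109** (1987) 249–301 [Balaban1987RG1] ((0.11) p. 253).
-/

set_option autoImplicit false

noncomputable section

namespace Summit.QuantumFields.YangMills.Theorems.UV3TopHaarPushforwardOfWeakClosedTop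

open scoped ENNReal
open MeasureTheory
open Literature.MathematicalPhysics.QuantumFieldTheory.Balaban1983to89
open Literature.MathematicalPhysics.QuantumFieldTheory.Balaban1983to89.T4AvgSensitivity (iterFrom)
open Literature.MathematicalPhysics.QuantumFieldTheory.Balaban1983to89.T3ContinuumYM3Torus
open Summit.QuantumFields.Balaban3D.Carriers
open Summit.QuantumFields.YangMills.BalabanUVNodes.N08PartialIteratesSufficiency (exists_partialIterates)
open Summit.QuantumFields.YangMills.BalabanUVNodes.N08PartialIteratesNecessity (partialIterates_le_add_of_weakClosed)
open Summit.QuantumFields.YangMills.Theorems.UV3PinnedStepOrganOfTopPartialIterates (partialIterates_eq_map_iterFrom)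

/-! ## §1 Generic: weak closure + ONE cap at the target level give the push-forward letter into that level -/

section Generic

variable {P : Params} {G : Type} [GaugeGroup G] [MeasurableSpace G] [HaarData G]
  (av : ∀ j, Averaging P j G) (hav : ∀ j, AvgAC (av j).avg)
include hav

/-- ★★ **WEAK CLOSURE BELOW `Kt` + ONE CAP AT `Kt` ⇒ EVERY SEGMENT ENDING AT `Kt` PUSHES HAAR TO AT MOST `(1 + C)`·HAAR**: if `(dU_k + ν_k)∘Ū_k⁻¹ ≤ dU_{k+1} + ν_{k+1}` for `k < Kt`
and `ν_Kt ≤ C·dU_Kt`, then `(dU_j)∘(iterFrom av j n)⁻¹ ≤ (1 + C)·dU_{j+n}` whenever `j + n = Kt` — N08 file 30 §1 (every partial iterate is dominated by every weakly-closed family,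
CLOSURE ONLY) at the canonical partial iterates, read in push-forward currency; no cap below `Kt` is used. [cite: Balaban1985UV3, (2) p.256 (bookkeeping); Balaban1985Averaging, (10) p.19; Balaban1987RG1, (0.11) p.253] -/
theorem map_iterFrom_le_of_weakClosed_topCap (Kt : ℕ) (ν : ∀ k, Measure (GaugeField P k G))
    (hstep : ∀ k, k < Kt → (fieldMeasure P k G + ν k).map (av k).avg ≤ fieldMeasure P (k + 1) G + ν (k + 1))
    (C : ℝ≥0∞) (hcap : ν Kt ≤ C • fieldMeasure P Kt G) (j n : ℕ) (hjn : j + n = Kt) :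
    (fieldMeasure P j G).map (iterFrom av j n) ≤ (1 + C) • fieldMeasure P (j + n) G := by
  obtain ⟨ι, hι0, hιs⟩ := exists_partialIterates av
  rw [← partialIterates_eq_map_iterFrom av hav ι hι0 hιs j n]
  subst hjn
  calc ι j (j + n) ≤ fieldMeasure P (j + n) G + ν (j + n) :=
        partialIterates_le_add_of_weakClosed (fun i => (hav i).1) ι hι0 hιs (j + n) ν hstep (j + n) le_rfl j (Nat.le_add_right j n)
    _ ≤ fieldMeasure P (j + n) G + C • fieldMeasure P (j + n) G := add_le_add le_rfl hcap
    _ = (1 + C) • fieldMeasure P (j + n) G := by rw [add_smul, one_smul]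

end Generic

/-! ## §2 At the lane: hTop from a weakly-closed family capped at the unit torus -/

section Lane

/-- ★★ **hTop FROM THE TOP-ONLY READING OF THE N08 v1 LETTER** (per family `F`): IF there is `A ≥ 0` such that at every run `K` some family `ν` of measures on the run's field
spaces is weakly closed under the pinned block averaging `avT3 F K` for `k < K` AND capped AT THE UNIT TORUS ONLY, `ν_K ≤ (e^{A} − 1)·dU_K`, THEN hTop(F) holds with `c := A`
(§1 with `1 + ofReal (e^{A} − 1) = ofReal (e^{A})`).  The caps g47's letter asks at the levels `k < K` are not used. [cite: Balaban1985UV3, (2) p.256 + (5) p.257 (bookkeeping); Balaban1985Averaging, (15) p.19; Balaban1987RG1, (0.11) p.253] -/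
theorem topHaarPushforward_of_weakClosed_topCap_avT3 (F : T3Family)
    (hN08top : ∃ A : ℝ, 0 ≤ A ∧ ∀ K : ℕ, ∃ ν : ∀ k, Measure (GaugeField (F.P K) k (Matrix.specialUnitaryGroup (Fin 2) ℂ)),
      (∀ k, k < K → (fieldMeasure (F.P K) k (Matrix.specialUnitaryGroup (Fin 2) ℂ) + ν k).map (avT3 F K k).avg ≤
        fieldMeasure (F.P K) (k + 1) (Matrix.specialUnitaryGroup (Fin 2) ℂ) + ν (k + 1)) ∧
      ν K ≤ ENNReal.ofReal (Real.exp A - 1) • fieldMeasure (F.P K) K (Matrix.specialUnitaryGroup (Fin 2) ℂ)) :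
    ∃ c : ℝ, 0 ≤ c ∧ ∀ (K j n : ℕ), j + n = K →
      (fieldMeasure (F.P K) j (Matrix.specialUnitaryGroup (Fin 2) ℂ)).map (iterFrom (avT3 F K) j n) ≤
        ENNReal.ofReal (Real.exp c) • fieldMeasure (F.P K) (j + n) (Matrix.specialUnitaryGroup (Fin 2) ℂ) := by
  obtain ⟨A, hA, hK⟩ := hN08top
  refine ⟨A, hA, fun K j n hjn => ?_⟩
  obtain ⟨ν, hstep, hcap⟩ := hK K
  have h1 : ENNReal.ofReal (Real.exp A) = 1 + ENNReal.ofReal (Real.exp A - 1) := by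
    rw [← ENNReal.ofReal_one, ← ENNReal.ofReal_add zero_le_one (sub_nonneg.2 (Real.one_le_exp hA)), add_sub_cancel]
  have h := map_iterFrom_le_of_weakClosed_topCap (avT3 F K) (avgAC_avT3 F K) K ν hstep _ hcap j n hjn
  rw [h1]
  subst hjn
  exact h

/-- **THE ALL-LEVELS LETTER IMPLIES THE TOP-ONLY LETTER** (trivially: keep the cap at `k = K`): g47's ✓`BalabanUVNodesN08KFoldTransportEnvelopeT3.hJ_of_weakClosed_avT3` hypothesis hN08
(closure + caps at every `k ≤ K`) gives hN08top. [cite: Balaban1985UV3, (2) p.256 (bookkeeping)] -/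
theorem weakClosed_topCap_of_weakClosed_avT3 (F : T3Family) {A₁ : ℝ} (hA₁ : 0 ≤ A₁)
    (hN08 : ∀ K : ℕ, ∃ ν : ∀ k, Measure (GaugeField (F.P K) k (Matrix.specialUnitaryGroup (Fin 2) ℂ)),
      (∀ k, k < K → (fieldMeasure (F.P K) k (Matrix.specialUnitaryGroup (Fin 2) ℂ) + ν k).map (avT3 F K k).avg ≤
        fieldMeasure (F.P K) (k + 1) (Matrix.specialUnitaryGroup (Fin 2) ℂ) + ν (k + 1)) ∧
      (∀ k, k ≤ K → ν k ≤ ENNReal.ofReal (Real.exp A₁ - 1) • fieldMeasure (F.P K) k (Matrix.specialUnitaryGroup (Fin 2) ℂ))) :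
    ∃ A : ℝ, 0 ≤ A ∧ ∀ K : ℕ, ∃ ν : ∀ k, Measure (GaugeField (F.P K) k (Matrix.specialUnitaryGroup (Fin 2) ℂ)),
      (∀ k, k < K → (fieldMeasure (F.P K) k (Matrix.specialUnitaryGroup (Fin 2) ℂ) + ν k).map (avT3 F K k).avg ≤
        fieldMeasure (F.P K) (k + 1) (Matrix.specialUnitaryGroup (Fin 2) ℂ) + ν (k + 1)) ∧
      ν K ≤ ENNReal.ofReal (Real.exp A - 1) • fieldMeasure (F.P K) K (Matrix.specialUnitaryGroup (Fin 2) ℂ) :=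
  ⟨A₁, hA₁, fun K => by
    obtain ⟨ν, hstep, hcap⟩ := hN08 K
    exact ⟨ν, hstep, hcap K le_rfl⟩⟩

/-- ★ **HENCE g47's ALL-LEVELS v1 LETTER hN08 ALSO GIVES hTop** (and so, by ✓K-23-TOP ∕ `ym-ust-19936-w8` g11's v3 face, the crux faces over hTop): only its closure clause and its cap at
the unit torus are consumed. [cite: Balaban1985UV3, (2) p.256 + (5) p.257 (bookkeeping); Balaban1987RG1, (0.11) p.253] -/
theorem topHaarPushforward_of_weakClosed_avT3 (F : T3Family) {A₁ : ℝ} (hA₁ : 0 ≤ A₁)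
    (hN08 : ∀ K : ℕ, ∃ ν : ∀ k, Measure (GaugeField (F.P K) k (Matrix.specialUnitaryGroup (Fin 2) ℂ)),
      (∀ k, k < K → (fieldMeasure (F.P K) k (Matrix.specialUnitaryGroup (Fin 2) ℂ) + ν k).map (avT3 F K k).avg ≤
        fieldMeasure (F.P K) (k + 1) (Matrix.specialUnitaryGroup (Fin 2) ℂ) + ν (k + 1)) ∧
      (∀ k, k ≤ K → ν k ≤ ENNReal.ofReal (Real.exp A₁ - 1) • fieldMeasure (F.P K) k (Matrix.specialUnitaryGroup (Fin 2) ℂ))) :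
    ∃ c : ℝ, 0 ≤ c ∧ ∀ (K j n : ℕ), j + n = K →
      (fieldMeasure (F.P K) j (Matrix.specialUnitaryGroup (Fin 2) ℂ)).map (iterFrom (avT3 F K) j n) ≤
        ENNReal.ofReal (Real.exp c) • fieldMeasure (F.P K) (j + n) (Matrix.specialUnitaryGroup (Fin 2) ℂ) :=
  topHaarPushforward_of_weakClosed_topCap_avT3 F (weakClosed_topCap_of_weakClosed_avT3 F hA₁ hN08)

end Lane

end Summit.QuantumFields.YangMills.Theorems.UV3TopHaarPushforwardOfWeakClosedTop

end
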